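import Summits.QuantumFields.YangMills.Theorems.UnitScaleTiltProp7AxialReprPrint
import Literature.MathematicalPhysics.QuantumFieldTheory.Balaban1983to89.B7AvgGaugeCovariance
import HarnessLib

/-!
# Route `UnitScaleTilt`, crux K1 child «MinimiserStabilityRegPr» (stmt-QuantumFields-19200), registered stub `stub_prop7From14` (skeleton birth_v7
# cc37a178…; leaf V3) — PRINT'S AXIAL GAUGE (1.19) (BASED LETTERS) IS A COMPLETE GAUGE OF THE GROUP (4) ON THE REGULAR SPACE: the (4)-element is
# UNIQUE ([Balaban1985RegularSpaces] p. 79 «The conditions (1.19) determine uniquely an element in each orbit given by the subgroup (1.14)»,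
# uniqueness half), and clause 1 of the stub is UNIQUENESS OF A POINT in print's space (18) — the twin of gen 7's `Prop7AxialSpace18` for print's
# letters (existence = `Prop7AxialReprPrint.exists_repr_inAx_based`)

Cell `ym3-torus` ∕ fleet seat `ym-ust-19200-p1` (gen 8; HUMAN RULING D-0037, YM ladder rung R3).  WHY.  Gen 7 proved, for the complete COMB gauge, that
it is a complete gauge of print's group (4) and hence that clause 1 of the stub is the uniqueness of a POINT in (18) (`Prop7AxialSpace18.
atMostOneCriticalOrbit_iff_unique_axial`).  The v8 re-cut of V3 runs through PRINT'S iterated axial gauge (1.19) (= the letters [Balaban1985RegularSpaces]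
Thm 2 is typed with), read on the `ℤᵈ` pullbacks based at the `k`-centre `x₀ = embIter k 0` (`Prop7AxialReprPrint`, p568814: existence of the
(4)-representative in the small-field regime).  THIS FILE supplies the uniqueness half for those letters and the point-form of clause 1.

WHAT IS PROVED (sorry-free, no definition).
§1 `ℤᵈ`: `axialFn_eq_of_inAx_torusLam` ((1.19) on `Λ_k = T^{(k)}` at every block), **`eq_one_of_inAx_gaugeAct`** — if `W` and `W^w` both lie in
   `Ax_k(T^{(k)}, U₀)` and `w = 1` on `Lᵏℤᵈ` (the corner-pinned (1.14)), then `w = 1`: downward induction through the levels by the gauge covariance of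
   the averages `\overline{(W^w)}ⁿ = (W̄ⁿ)^{w_n}` ([Balaban1985Averaging] (11), `B7AvgGaugeCovariance.avgIter_gaugeAct`; `G` `AvgClosed`, `W` in the Prop.-2 window).
§2 Setup torus, `SU(N)` (`N ≤ 21`): `transl_embIter_zero_smul` (`x₀ + Lᵏℤᵈ` = the `k`-centres), **`eq_one_of_axial_print_based`** (a gauge transformation
   trivial at every `k`-centre with `W`, `W^v` both based-(1.19)-axial is trivial; `W ∈ 𝔄_k(α)`, `α` Prop.-2-small).
§3 T³ carrier: `apply_embIter_eq_one_of_descTransf`, `window_of_le` (threshold `ε₀ ≤ min{1/(6C₀(3)C₁), c₂′(3,L)/(4C₁)}` ⟹ Prop.-2 window at `2C₁ε₀`),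
   **`eq_one_of_axial_print`** (`W ∈ 𝔘_k(C₁ε₀)`, `v` trivial on the comparison lattice), **`eq_of_sameOrbit_of_axial_print`**, and
   **`atMostOneCriticalOrbit_iff_unique_axial_print`**: for `U₀ ∈ 𝔘_k(C₁ε₀)` and `ε₀` in the window, (6)(ε₀) has at most one R2-critical (4)-orbit
   IFF it contains at most one based-(1.19)-axial R2-critical configuration.

HONEST SCOPE.  Small-field regime only (print's: (6)(ε₀), (14)); based letters (CARD-19200-V3-g8 §1(c)); nothing of [Balaban1985RegularSpaces] Thm 2
∕ [Balaban1985Variational] Props 5–6 is claimed.  Count-neutral helper toward stmt-QuantumFields-19200 (`--supports`), not a proof of the stub.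

References: T. Bałaban, CMP 99 (1985) 75–102 [Balaban1985RegularSpaces] ((1.14) p.78, (1.19) p.79, p.79); CMP 102 (1985) 277–309 [Balaban1985Variational]
((4) p.278, (18) p.280, p.281); CMP 98 (1985) 17–51 [Balaban1985Averaging] ((11) p.19, Prop. 2 p.26); [Balaban1987RG1] (0.1) p.252.
-/

noncomputable section

namespace Summit.QuantumFields.YangMills.Theorems.Prop7AxialSpace18Print

open Literature.MathematicalPhysics.QuantumFieldTheory.Balaban1983to89
open B7Prop1Explicit renaming Site → LSite
open B7Prop1Explicit (e boxVec axialFn gaugeAct U1)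
open B7Prop2Explicit (avgIter pdev C0 c2' C0_pos c2'_pos AvgClosed)
open B7Prop2SpecialUnitary (specialUnitaryUnits specialUnitaryUnits_le_U1)
open B7AvgGaugeCovariance (uLev uLev_apply uLev_zero uLev_smul avgIter_gaugeAct)
open B7AvgClosedSpecialUnitarySharp (avgClosed_specialUnitary_of_le_twentyone)
open B7Eq84Concrete (fl_decomp brem)
open B8Ineq130 (fl)
open B8Ineq132 (InAk)
open B8Eq115GaugeFixing (axialFn_gaugeAct)
open B8Eq119TwistedAxial (InAx inAx_iff)
open B8Thm4TorusAt (torusLam mem_torusLam_iff)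
open B15DeterminingSets (embIter)
open B10Eq27TorusAxialLog (transl transl_apply pull unitsField toUField suIncl val_suIncl)
open B8Thm2SetupTorus (pullGauge pullGauge_apply toUGauge)
open Summit.QuantumFields.YangMills.Theorems.Prop7ChartInjectivityPrint (exists_under)
open Summit.QuantumFields.YangMills.Theorems.Prop7AxialReprPrint (embIter_eq_transl pull_toUField_mem pdev_pull_lt pull_toUField_gaugeAct inAk_pull_of_regPr)
open Summit.QuantumFields.YangMills.Theorems.Prop7FlatHolonomy (sitesPerDir_zero_eq_mul_pow transfUp_eq_embIter)

/-! ## §1 On `ℤᵈ`: a transformation of the corner-pinned group preserving the (1.19)-surface is trivial (small-field regime) -/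

section Zd

variable {d : ℕ} {𝔸 : Type*} [NormedRing 𝔸] [NormOneClass 𝔸] [NormedAlgebra ℂ 𝔸] [CompleteSpace 𝔸]

omit [NormOneClass 𝔸] in
/-- (1.19) on `Λ_k = T^{(k)}` in the `axialFn` form at EVERY block: `W̄ⁿ(Γ_{Lz,Lz+r}) = Ū₀ⁿ(Γ_{Lz,Lz+r})`, `n < k` (every block lies under some
top site, `Prop7ChartInjectivityPrint.exists_under`). [cite: Balaban1985RegularSpaces, (1.19) p.79] -/
theorem axialFn_eq_of_inAx_torusLam {L : ℕ} (hL : 1 ≤ L) {k : ℕ} {U₀ W : LSite d → Fin d → 𝔸ˣ}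
    (h : InAx L k (torusLam k) U₀ W) {n : ℕ} (hn : n < k) (z : LSite d) (r : Fin d → Fin L) :
    axialFn (avgIter L W n) ((L : ℤ) • z) ((L : ℤ) • z + boxVec L r) = axialFn (avgIter L U₀ n) ((L : ℤ) • z) ((L : ℤ) • z + boxVec L r) := by
  obtain ⟨x, hx⟩ := exists_under hL (k - (n + 1)) z
  exact (inAx_iff L k (torusLam k) U₀ W).1 h k (by omega) le_rfl x ((mem_torusLam_iff k k x).2 rfl) n hn z hx r

/-- **UNIQUENESS OF THE (1.14)-ELEMENT FOR THE GAUGE (1.19), `ℤᵈ`, CORNER-PINNED GROUP** ([Balaban1985RegularSpaces] p. 79 «The conditions (1.19)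
determine uniquely an element in each orbit given by the subgroup (1.14)», uniqueness half, STRONG form): if `W` and `W^w` both lie in
`Ax_k(T^{(k)}, U₀)` and `w = 1` on the top lattice `Lᵏℤᵈ`, then `w = 1` identically — downward induction through the levels using the gauge
covariance `\overline{(W^w)}ⁿ = (W̄ⁿ)^{w_n}` of the averages ([Balaban1985Averaging] (11), `B7AvgGaugeCovariance.avgIter_gaugeAct`: `G`
`AvgClosed`, `W` `G`-valued in the Prop.-2 window, `w` with `|w|, |w⁻¹| ≤ 1`).
[cite: Balaban1985RegularSpaces, p.79 (sentence after (1.20)), (1.14) p.78; Balaban1985Averaging, (11) p.19] -/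
theorem eq_one_of_inAx_gaugeAct (L : ℕ) (hL : 2 ≤ L) {G : Subgroup 𝔸ˣ} (hG : AvgClosed d L G) (k : ℕ)
    (U₀ W : LSite d → Fin d → 𝔸ˣ) (hW : ∀ x κ, W x κ ∈ G) {w : LSite d → 𝔸ˣ} (hw : ∀ x, w x ∈ U1 𝔸)
    {α : ℝ} (hα : 0 < α) (hα3 : C0 d * α ≤ 1 / 3) (hα2 : 2 * α ≤ c2' d L) (h52 : pdev W < α * (((L : ℝ) ^ k)⁻¹) ^ 2)
    (hAx : InAx L k (torusLam k) U₀ W) (hAx' : InAx L k (torusLam k) U₀ (gaugeAct w W)) (htop : ∀ z : LSite d, w (((L : ℤ) ^ k) • z) = 1) :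
    w = 1 := by
  have hL1 : 1 ≤ L := le_trans (by norm_num) hL
  have hcov := avgIter_gaugeAct L hL hG k W hW hw hα hα3 hα2 h52
  -- `w_{k−i} ≡ 1` by induction on the depth `i`
  have key : ∀ i ≤ k, ∀ x : LSite d, uLev L w (k - i) x = 1 := by
    intro i
    induction i with
    | zero => intro _ x; rw [Nat.sub_zero, uLev_apply]; exact htop x
    | succ i ih =>
      intro hi x
      have hn : k - (i + 1) < k := by omega
      have hn1 : k - (i + 1) + 1 = k - i := by omega
      have e := axialFn_eq_of_inAx_torusLam hL1 hAx' hn (fl L x) (brem L hL1 x)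
      rw [← axialFn_eq_of_inAx_torusLam hL1 hAx hn (fl L x) (brem L hL1 x), hcov _ hn.le, axialFn_gaugeAct, uLev_smul, hn1,
        ih (by omega), one_mul, fl_decomp hL1 x] at e
      -- `e : A * (w_n x)⁻¹ = A`
      have e' := mul_left_cancel (a := axialFn (avgIter L W (k - (i + 1))) ((L : ℤ) • fl L x) x) (e.trans (mul_one _).symm)
      exact inv_eq_one.mp e'
  funext x
  have h0 := key k le_rfl x
  rwa [Nat.sub_self, uLev_zero] at h0

end Zd

/-! ## §2 At the Setup torus: the (4)-element (pinned at the `k`-centres) preserving print's based (1.19)-surface is trivial -/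

section Torus

open scoped Matrix.Norms.L2Operator

variable {P : Params} {N : ℕ} [NeZero N]

/-- Every translate `x₀ + Lᵏ·z` of the base centre `x₀ = embIter k 0` by `Lᵏℤᵈ` is a `k`-centre `embIter k y` (coordinates of `z` mod `sitesPerDir k`;
`sitesPerDir 0 = sitesPerDir k · Lᵏ`, `Prop7AxialReprPrint.embIter_eq_transl`). [cite: Balaban1987RG1, (0.1) p.252] -/
theorem transl_embIter_zero_smul {k : ℕ} (hk : k ≤ P.m + P.K) (z : LSite P.d) :
    ∃ y : Site P k, transl (embIter k (0 : Site P k)) (((P.L : ℤ) ^ k) • z) = embIter k y := by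
  refine ⟨fun μ => ((z μ : ℤ) : ZMod (P.sitesPerDir k)), ?_⟩
  have hN : P.sitesPerDir 0 = P.sitesPerDir k * P.L ^ k := sitesPerDir_zero_eq_mul_pow hk
  conv_rhs => rw [embIter_eq_transl hk]
  funext μ
  rw [transl_apply, transl_apply]
  congr 1
  simp only [Pi.smul_apply, smul_eq_mul]
  rw [ZMod.intCast_eq_intCast_iff_dvd_sub, ZMod.val_intCast, hN]
  refine ⟨-(z μ / (P.sitesPerDir k : ℤ)), ?_⟩
  -- `z % N = z - N * (z / N)`
  have hde := Int.emod_def (z μ) (P.sitesPerDir k : ℤ)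
  push_cast
  linear_combination ((P.L : ℤ) ^ k) * hde

/-- **UNIQUENESS OF THE (4)-ELEMENT FOR PRINT'S AXIAL GAUGE (1.19) AT THE SETUP-TORUS OBJECTS** (based letters, small-field regime): for `SU(N)`
(`N ≤ 21`) torus configurations `U₀`, `W` with `W` in the all-torus class `𝔄_k(α)` (`α` Prop.-2-small) and a gauge transformation `v` TRIVIAL AT
EVERY `k`-CENTRE, if `W` and `W^v` both lie in the (1.19)-gauge relative to `U₀` read on the pullbacks based at `x₀ = embIter k 0`, then `v = 1`.
[cite: Balaban1985RegularSpaces, p.79 (sentence after (1.20)), (1.14) p.78; Balaban1985Variational, (4) p.278] -/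
theorem eq_one_of_axial_print_based (hN : N ≤ 21) {k : ℕ} (hk : k ≤ P.m + P.K) {η α : ℝ} (hα : 0 < α)
    (hα3 : C0 P.d * (2 * α) ≤ 1 / 3) (hα2 : 2 * (2 * α) ≤ c2' P.d P.L)
    (U₀ W : GaugeField P 0 (Matrix.specialUnitaryGroup (Fin N) ℂ))
    (hW : InAk P.L k η α (fun _ => (Set.univ : Set (LSite P.d))) (pull (unitsField (toUField W)) 0))
    {v : GaugeTransf P 0 (Matrix.specialUnitaryGroup (Fin N) ℂ)} (hv : ∀ y : Site P k, v (embIter k y) = 1)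
    (hAx : InAx P.L k (torusLam k) (pull (unitsField (toUField U₀)) (embIter k (0 : Site P k)))
      (pull (unitsField (toUField W)) (embIter k (0 : Site P k))))
    (hAx' : InAx P.L k (torusLam k) (pull (unitsField (toUField U₀)) (embIter k (0 : Site P k)))
      (pull (unitsField (toUField (GaugeField.gaugeAct v W))) (embIter k (0 : Site P k)))) : v = fun _ => 1 := by
  letI : CStarAlgebra (Matrix (Fin N) (Fin N) ℂ) := B10Eq29TubeLine.cstarAlgebraMatrix N
  set x₀ : Site P 0 := embIter k (0 : Site P k) with hx₀
  have hL2 : 2 ≤ P.L := P.hL.2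
  have hG : AvgClosed P.d P.L (specialUnitaryUnits (Fin N)) := avgClosed_specialUnitary_of_le_twentyone hN P.d P.L
  have hmem : ∀ z κ, pull (unitsField (toUField W)) x₀ z κ ∈ specialUnitaryUnits (Fin N) := pull_toUField_mem W x₀
  have hwU : ∀ z, pullGauge (fun x => Unitary.toUnits (toUGauge P N v x)) x₀ z ∈ U1 (Matrix (Fin N) (Fin N) ℂ) := fun z => by
    rw [pullGauge_apply]; exact specialUnitaryUnits_le_U1 (B8Thm2SetupTorus.toUnits_toUGauge_mem v _)
  have h2α : 0 < 2 * α := by positivity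
  have h52 : pdev (pull (unitsField (toUField W)) x₀) < 2 * α * (((P.L : ℝ) ^ k)⁻¹) ^ 2 := pdev_pull_lt hα hW x₀
  rw [pull_toUField_gaugeAct] at hAx'
  have htop : ∀ z : LSite P.d, pullGauge (fun x => Unitary.toUnits (toUGauge P N v x)) x₀ (((P.L : ℤ) ^ k) • z) = 1 := by
    intro z
    obtain ⟨y, hy⟩ := transl_embIter_zero_smul hk z
    rw [pullGauge_apply, hy, B8Thm2SetupTorus.toUGauge_apply, hv y, map_one, map_one]
  have hw1 := eq_one_of_inAx_gaugeAct P.L hL2 hG k _ _ hmem hwU h2α hα3 hα2 h52 hAx hAx' htop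
  funext x
  have hx := congrFun hw1 (B10Eq27TorusAxialLog.rel x₀ x)
  rw [pullGauge_apply, B10Eq27TorusAxialLog.transl_rel, Pi.one_apply] at hx
  have hx' := congrArg (fun g : (Matrix (Fin N) (Fin N) ℂ)ˣ => (g : Matrix (Fin N) (Fin N) ℂ)) hx
  simp only [Unitary.val_toUnits_apply, B8Thm2SetupTorus.toUGauge_apply, val_suIncl, Units.val_one] at hx'
  exact Subtype.ext (by rw [hx']; rfl)

end Torus

/-! ## §3 At the T³ carrier: print's based (1.19)-gauge is a COMPLETE gauge of the group (4) on (6)(ε₀); clause 1 as uniqueness of a point -/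

section T3

open scoped Matrix.Norms.L2Operator
open Literature.MathematicalPhysics.QuantumFieldTheory.Balaban1983to89.T3ContinuumYM3Torus
open Literature.MathematicalPhysics.QuantumFieldTheory.Balaban1983to89.T3UnitLawDensityEML (ℰp)
open Literature.MathematicalPhysics.QuantumFieldTheory.Balaban1983to89.T3DescentFibreTower
open Literature.MathematicalPhysics.QuantumFieldTheory.Balaban1983to89.T3PrintedRegularMinimiser
open Literature.MathematicalPhysics.QuantumFieldTheory.Balaban1983to89.T3PrintedMinimiserExistence (regPr_mono)
open Literature.MathematicalPhysics.QuantumFieldTheory.Balaban1983to89.T3PrintedRegularOrbits (descTransf sites_eq gaugeAct_mem_regFibrePr_iff_of_trivial)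
open Literature.MathematicalPhysics.QuantumFieldTheory.Balaban1983to89.T3LevelShift (siteShift)
open T3Thm1Carrier (varProblem3)
open T3Thm1CarrierNative (IsCritR2)
open T3SectALandauChart (pos_of_regPr isCritR2_gaugeAct_of_trivial sameOrbit_refl sameOrbit_symm sameOrbit_trans)
open Summit.QuantumFields.YangMills.Theorems.Prop7AxialReprPrint (exists_repr_inAx_based)

variable (F : T3Family) {n K : ℕ} (h : n ≤ K)

/-- `u↓ = 1` read at the `(K−n)`-centres: `descTransf u = 1 → u (embIter (K−n) y) = 1`. [cite: Balaban1985Variational, (4) p.278] -/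
theorem apply_embIter_eq_one_of_descTransf {u : GaugeTransf (F.P K) 0 (Matrix.specialUnitaryGroup (Fin 2) ℂ)}
    (hu : descTransf F n K h u = fun _ => 1) (y : Site (F.P K) (K - n)) : u (embIter (K - n) y) = 1 := by
  have h1 := congrFun hu ((siteShift (sites_eq F n K h)).symm y)
  unfold descTransf at h1
  rwa [transfUp_eq_embIter, Equiv.apply_symm_apply] at h1

/-- The [Balaban1985Averaging] Prop.-2 window at the radius `2C₁ε₀` from the threshold `ε₀ ≤ min{1/(6C₀(3)C₁), c₂′(3,L)/(4C₁)}` (d = 3 carriers).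
[cite: Balaban1985Averaging, Prop. 2 (52)–(53) p.26] -/
theorem window_of_le {C₁ ε₀ : ℝ} (hC₁ : 1 ≤ C₁) (hεe : ε₀ ≤ min (1 / (6 * C0 3 * C₁)) (c2' 3 F.L / (4 * C₁))) :
    C0 (F.P K).d * (2 * (C₁ * ε₀)) ≤ 1 / 3 ∧ 2 * (2 * (C₁ * ε₀)) ≤ c2' (F.P K).d (F.P K).L := by
  have hd : (F.P K).d = 3 := rfl
  have hLP : (F.P K).L = F.L := rfl
  have hC0 : 0 < C0 3 := C0_pos _
  have hC₁0 : 0 < C₁ := by linarith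
  have he1 := (le_div_iff₀ (by positivity)).1 (hεe.trans (min_le_left _ _))
  have he2 := (le_div_iff₀ (by positivity)).1 (hεe.trans (min_le_right _ _))
  rw [hd, hLP]
  constructor <;> nlinarith

/-- **PRINT'S (1.19)-GAUGE (BASED LETTERS) DETERMINES THE (4)-ELEMENT AT THE T³ CARRIER**: for `W ∈ 𝔘_k(C₁ε₀)` (both clauses of (2)), `C₁ ≥ 1`,
`ε₀ ≤ min{1/(6C₀(3)C₁), c₂′(3,L)/(4C₁)}`, if `v` is trivial on the comparison lattice and both `W`, `W^v` lie in the based (1.19)-gauge relative to `U₀`,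
then `v = 1`. [cite: Balaban1985RegularSpaces, p.79 (sentence after (1.20)); Balaban1985Variational, (4) p.278, (18) p.280] -/
theorem eq_one_of_axial_print {C₁ ε₀ : ℝ} (hC₁ : 1 ≤ C₁) (hεe : ε₀ ≤ min (1 / (6 * C0 3 * C₁)) (c2' 3 F.L / (4 * C₁)))
    (U₀ W : GaugeField (F.P K) 0 (Matrix.specialUnitaryGroup (Fin 2) ℂ)) (hW : RegPr F n K (C₁ * ε₀) W)
    {v : GaugeTransf (F.P K) 0 (Matrix.specialUnitaryGroup (Fin 2) ℂ)} (hv : descTransf F n K h v = fun _ => 1)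
    (hAx : InAx (F.P K).L (K - n) (torusLam (K - n)) (pull (unitsField (toUField U₀)) (embIter (K - n) (0 : Site (F.P K) (K - n))))
      (pull (unitsField (toUField W)) (embIter (K - n) (0 : Site (F.P K) (K - n)))))
    (hAx' : InAx (F.P K).L (K - n) (torusLam (K - n)) (pull (unitsField (toUField U₀)) (embIter (K - n) (0 : Site (F.P K) (K - n))))
      (pull (unitsField (toUField (GaugeField.gaugeAct v W))) (embIter (K - n) (0 : Site (F.P K) (K - n))))) : v = fun _ => 1 := by
  have hε₀ : 0 < C₁ * ε₀ := pos_of_regPr F hW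
  obtain ⟨hα3, hα2⟩ := window_of_le F (K := K) hC₁ hεe
  have hk : K - n ≤ (F.P K).m + (F.P K).K := by show K - n ≤ F.m + K; omega
  exact eq_one_of_axial_print_based (P := F.P K) (by norm_num) hk hε₀ hα3 hα2 U₀ W (inAk_pull_of_regPr F hε₀.le hW)
    (apply_embIter_eq_one_of_descTransf F h hv) hAx hAx'

/-- **TWO BASED-(1.19)-AXIAL CONFIGURATIONS ON ONE (4)-ORBIT ARE EQUAL** (relative to the same background; the first in `𝔘_k(C₁ε₀)`, `ε₀` in the
window): the (4)-element between them is `1` (`eq_one_of_axial_print`). [cite: Balaban1985RegularSpaces, p.79 (sentence after (1.20)); Balaban1985Variational, (4) p.278] -/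
theorem eq_of_sameOrbit_of_axial_print {C₁ ε₀ : ℝ} (hC₁ : 1 ≤ C₁) (hεe : ε₀ ≤ min (1 / (6 * C0 3 * C₁)) (c2' 3 F.L / (4 * C₁)))
    (U₀ U U' : GaugeField (F.P K) 0 (Matrix.specialUnitaryGroup (Fin 2) ℂ)) (hU : RegPr F n K (C₁ * ε₀) U)
    (hax : InAx (F.P K).L (K - n) (torusLam (K - n)) (pull (unitsField (toUField U₀)) (embIter (K - n) (0 : Site (F.P K) (K - n))))
      (pull (unitsField (toUField U)) (embIter (K - n) (0 : Site (F.P K) (K - n)))))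
    (hax' : InAx (F.P K).L (K - n) (torusLam (K - n)) (pull (unitsField (toUField U₀)) (embIter (K - n) (0 : Site (F.P K) (K - n))))
      (pull (unitsField (toUField U')) (embIter (K - n) (0 : Site (F.P K) (K - n)))))
    (hsame : T3Thm1Carrier.SameOrbit F n K h U U') : U = U' := by
  obtain ⟨w, hw, rfl⟩ := hsame
  have h1 := eq_one_of_axial_print F h hC₁ hεe U₀ U hU hw hax hax'
  rw [h1]
  funext b
  simp [GaugeField.gaugeAct]

/-- **CLAUSE 1 OF THE STUB AS UNIQUENESS OF A POINT IN PRINT'S SPACE (18)** ([Balaban1985Variational] p. 281 «we have reduced a proof of the existence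
and the uniqueness of critical configurations in the space (18) …», here with (18)'s axial gauge = [Balaban1985RegularSpaces] (1.19) in the based
reading), in print's regime: for `C₁ ≥ 1`, `ε₀ ≤ min{1/(6C₀(3)C₁), c₂′(3,L)/(4C₁)}` and a background `U₀ ∈ 𝔘_k(C₁ε₀)`, print's regular fibre (6)(ε₀) of `V`
has at most one R2-critical (4)-orbit IFF it contains at most ONE based-(1.19)-axial (relative to `U₀`) R2-critical configuration.  Existence of the
representative: `Prop7AxialReprPrint.exists_repr_inAx_based`; uniqueness: `eq_of_sameOrbit_of_axial_print`.
[cite: Balaban1985Variational, (18) p.280, Prop. 2 p.281; Balaban1985RegularSpaces, (1.19) p.79, p.79 (sentence after (1.20))] -/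
theorem atMostOneCriticalOrbit_iff_unique_axial_print {C₁ ε₀ : ℝ} (hC₁ : 1 ≤ C₁)
    (hεe : ε₀ ≤ min (1 / (6 * C0 3 * C₁)) (c2' 3 F.L / (4 * C₁))) (V : GaugeField (F.P n) 0 (Matrix.specialUnitaryGroup (Fin 2) ℂ))
    (U₀ : GaugeField (F.P K) 0 (Matrix.specialUnitaryGroup (Fin 2) ℂ)) (hU₀ : RegPr F n K (C₁ * ε₀) U₀) :
    (varProblem3 F n K h).AtMostOneCriticalOrbit ε₀ V ↔
      ∀ U U' : GaugeField (F.P K) 0 (Matrix.specialUnitaryGroup (Fin 2) ℂ),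
        U ∈ regFibrePr F n K h ε₀ V → IsCritR2 F n K h V U →
        InAx (F.P K).L (K - n) (torusLam (K - n)) (pull (unitsField (toUField U₀)) (embIter (K - n) (0 : Site (F.P K) (K - n))))
          (pull (unitsField (toUField U)) (embIter (K - n) (0 : Site (F.P K) (K - n)))) →
        U' ∈ regFibrePr F n K h ε₀ V → IsCritR2 F n K h V U' →
        InAx (F.P K).L (K - n) (torusLam (K - n)) (pull (unitsField (toUField U₀)) (embIter (K - n) (0 : Site (F.P K) (K - n))))
          (pull (unitsField (toUField U')) (embIter (K - n) (0 : Site (F.P K) (K - n)))) →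
        U = U' := by
  have hC₁0 : 0 < C₁ := by linarith
  have ha : 0 < C₁ * ε₀ := pos_of_regPr F hU₀
  have hε₀ : 0 < ε₀ := (pos_iff_pos_of_mul_pos ha).1 hC₁0
  have hmono : ∀ {U : GaugeField (F.P K) 0 (Matrix.specialUnitaryGroup (Fin 2) ℂ)}, RegPr F n K ε₀ U → RegPr F n K (C₁ * ε₀) U :=
    fun hU => regPr_mono F (by nlinarith) hU
  obtain ⟨hα3, hα2⟩ := window_of_le F (K := K) hC₁ hεe
  have hk : K - n ≤ (F.P K).m + (F.P K).K := by show K - n ≤ F.m + K; omega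
  constructor
  · intro H U U' hU hc hax hU' hc' hax'
    obtain ⟨hUfib, hUreg⟩ := (mem_regFibrePr_iff F).mp hU
    obtain ⟨hU'fib, hU'reg⟩ := (mem_regFibrePr_iff F).mp hU'
    exact eq_of_sameOrbit_of_axial_print F h hC₁ hεe U₀ U U' (hmono hUreg) hax hax' (H U U' hUreg hUfib hc hU'reg hU'fib hc')
  · intro H U U'' hUreg hUfib hc hU''reg hU''fib hc''
    have hU : U ∈ regFibrePr F n K h ε₀ V := (mem_regFibrePr_iff F).mpr ⟨hUfib, hUreg⟩
    have hU'' : U'' ∈ regFibrePr F n K h ε₀ V := (mem_regFibrePr_iff F).mpr ⟨hU''fib, hU''reg⟩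
    obtain ⟨v, hv, hax⟩ := exists_repr_inAx_based (P := F.P K) (by norm_num) hk ha hα3 hα2 U₀ U
      (inAk_pull_of_regPr F ha.le hU₀) (inAk_pull_of_regPr F ha.le (hmono hUreg))
    obtain ⟨v'', hv'', hax''⟩ := exists_repr_inAx_based (P := F.P K) (by norm_num) hk ha hα3 hα2 U₀ U''
      (inAk_pull_of_regPr F ha.le hU₀) (inAk_pull_of_regPr F ha.le (hmono hU''reg))
    have hdv : descTransf F n K h v = fun _ => 1 := by
      funext x; unfold descTransf; rw [transfUp_eq_embIter]; exact hv _
    have hdv'' : descTransf F n K h v'' = fun _ => 1 := by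
      funext x; unfold descTransf; rw [transfUp_eq_embIter]; exact hv'' _
    have hmem := (gaugeAct_mem_regFibrePr_iff_of_trivial F h hε₀.le hdv U V).mpr hU
    have hmem'' := (gaugeAct_mem_regFibrePr_iff_of_trivial F h hε₀.le hdv'' U'' V).mpr hU''
    have heq := H _ _ hmem (isCritR2_gaugeAct_of_trivial F h hdv hc) (hax _) hmem'' (isCritR2_gaugeAct_of_trivial F h hdv'' hc'') (hax'' _)
    -- `U ~ U^v = U''^{v''} ~ U''`
    have h1 : T3Thm1Carrier.SameOrbit F n K h U (GaugeField.gaugeAct v'' U'') := heq ▸ ⟨v, hdv, rfl⟩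
    exact sameOrbit_trans F h h1 (sameOrbit_symm F h ⟨v'', hdv'', rfl⟩)

end T3

end Summit.QuantumFields.YangMills.Theorems.Prop7AxialSpace18Print

end
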